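import Summits.RiemannHypothesis.RiemannHypothesis.Theorems.TiltedLandingLaw421R3FormsQ

/-! # TiltedLandingLaw421R3BotQ
SUPPORT module for crux `TiltedLandingLaw421` (stmt-RiemannHypothesis-24774), `--supports … --as helper` only: proves no stub, no crux; fully proved (no `sorry`).
W-08 ROUND-3b (director (CA334) option (Q) / (CA335) rule: BAND-quadratic (Markov) tracking window `(max (|u.re − x₀| − R/2) 0)² + j·(u.im)² ≤ j·Hs²` (aperture R/2; level 0 = `StCol' 0` verbatim) as conjunct 4 of `RhW08.QuadW.StColQ'`, replacing the linear column clause `|u.re − x₀| ≤ R/2 + j·(s/4)` of `StCol'` (C6 ADD-86 frame A / ADD-92 frame C; (CA333) HOLD); node `RhW08.SealSwapQ.law421T_of_alphaFreeQ`, stub texts `RhW08.SealSwapQ.RestSuccBotQ`/`RestRateBotQ`, composition `law421T_of_succ_rateQ`, INIT♯^Q from INIT♯ by `restInitBotQ_of_restInitBot` (typing-robust, rev d), NO α stub; tracked-class typing (iv) BAND MEMBERSHIP `StTrkDQ := StColQ'` (C1 WORDS-60/60b/61 part-1 image `splitQ1-R3QuadW-band-W08-C1-rh-idea-5-g24.lean`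 0a4973de over C4 rev d parts 2/3; `band_step'`/`band_of_quad'`/`band_of_hull'` proved: BAND ⊇ Q, BAND ⊇ HULL); part-1 typing keyed by director g21 on the bus per the (CA335) rule (see the tenure CERT); parts 2/3 byte-identical under every part-1 typing)
cut by tenure rh-tenure-earlyapp-1 g7 from the single rc-0 base `monolithK29-band-W08-C1-rh-idea-5-g24.lean` sha256 d9d5cc26bdbc420bb637c77656e7eaed80199db59ff477a17aa0c34a6c080e5c (C1 g24 WORDS-61 (band) over C4 g26 §K.29 rev d base monolithK29-band-W08-C1-rh-idea-5-g24.lean d9d5cc26bdbc420b): decl blocks byte-verbatim, base order, dependency closure of the roots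
{AlphaSealTrkSQ, lineageLawTrkSQ, alphaTrkS_ofQ, law421T_of_round3SQ, alphaSealTrkS_botQ, law421T_of_alphaFreeQ, preHorizon_depth_leQ, exists_readyR2_leQ, exists_readyR2_le_alphaFreeQ, RestSuccBotQ, RestRateBotQ, RestInitBotQ, rateRestTrkS_bot_iffQ, zRestTrkSBot_of_succ_rateQ, restSuccBot_of_botQ, restRateBot_of_botQ, zRestTrkSHFR_bot_iff_succ_rateQ, law421T_of_succ_rateQ, exists_readyR2_le_of_succ_rateQ, chargedBot_iffQ, restInitBot_iff_purseQ, restInitBot_of_rateQ, rootHeight_stTrkDQ_le, heightBudget_stTrkD_le_stTrkDQ, restInitBotQ_of_restInitBot} minus every declaration already LANDED in the W-08 tree chain (#986 R2StSwap · #988 R2Ready · #991 R2TrkD · #994 R2NodeD · #998 R2NodeDR · #999 R2CoreP · #1000 R2FlatM · #1007 R3Forms · #1008 R3Bot).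
K = kernel-checked lemmas about MODEL sockets (combs / polynomials), not ζ/Ξ. Typed ≠ proved; RH is not proved; 24774 OPEN. -/

namespace RhW08.SealSwapQ

open Complex
open RhIdea6.G17.W07C7 RhIdea6.G17.W07C7.Rev6 RhIdea6.G18.W07C8.Law421BirthS RhIdea6.G19.W07C11.Seam
open RhIdea6.G20.W07C12.Frac RhIdea6.G20.W07C12.StColP RhW07.C12.FieldSplit RhIdea6.G21.W07C13.TentMax
open RhW07.C14.TwoSided RhW07.C14.Classes RhW07.C14.Lineage RhW07.C14.Booking
open RhW07.C13.Heredity RhIdea6.G22.W07C15pre.Injection RhW07.E3.Cell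
open RhW07.E3.Lit
open RhW08.Round1 RhW08.StSwap RhW08.Round2 RhW08.QuadW
open RhW08.SealSwap (PBot)

section Family

/-- ★★ §K.16b **α(Pσ)** — at a sealed lowest non-ready tracked state the tracked successor sits `s/4` lower. (`AlphaSealTrkSQ PSealC4` IS `AlphaSealTrkD′`.) -/
def AlphaSealTrkSQ (Pσ : StatePred) : Prop := IsolatedPairDropLowG (1 / 4) Pσ StTrkDQ ReadyR2

/-- (K) L2′ for every member of the family (`lineageLawG_sigmaMin`). -/
theorem lineageLawTrkSQ (Pσ : StatePred) : LineageLawG (PTrkSQ Pσ) StTrkDQ ReadyR2 EmptyTrkDQ (SigmaMinTrkSQ Pσ) (tentMeterTrkD (3 / 2)) :=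
  lineageLawG_sigmaMin

/-- (K) α(Pσ) transfers to the disjunctive charge co-predicate for free. -/
theorem alphaTrkS_ofQ {Pσ : StatePred} (h : AlphaSealTrkSQ Pσ) : IsolatedPairDropLowG (1 / 4) (PTrkSQ Pσ) StTrkDQ ReadyR2 :=
  isolatedPairDropLowG_pOr_succOf h

/-- ★★★ §K.16b (K) **THE NODE FOR EVERY SEAL**: `β(Pσ) → α(Pσ) → TiltedLandingLaw421` (the glue of `law421T_of_round2DFR`, seal abstracted). -/
theorem law421T_of_round3SQ (Pσ : StatePred) (hR : ZRestTrkSHFRQ Pσ) (hα : AlphaSealTrkSQ Pσ) :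
    Summit.RiemannHypothesis.RiemannHypothesis.Theses.EarlyAppointments.TiltedLandingLaw421 :=
  law421T_of_descentSig3
    (RhW08.Round2.descentSig3_of_lineageHF le_rfl stateFree_readyR2 (landLe3_readyR2 _) upperStates_stTrkDQ
      (hasLowestSig_of_levelFinite levelFinite_stTrkDQ)
      (initHeightG_heightBudget levelFinite_stTrkDQ init0Sig_stTrkDQ (tentMeterTrkD (3 / 2))) (lineageLawTrkSQ Pσ) hR (alphaTrkS_ofQ hα))
    analyticHeredity_landed
end Family

section SealSwap

/-- ★ (K) the α of the EMPTY seal is trivially true. -/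
theorem alphaSealTrkS_botQ : AlphaSealTrkSQ PBot := fun _ _ _ _ _ _ _ _ _ _ _ _ _ hp => hp.elim

/-- ★★★ §K.16b (K) **THE α-FREE NODE**: the β of the empty seal ALONE closes the crux (its α is `alphaSealTrkS_botQ`). -/
theorem law421T_of_alphaFreeQ (hR : ZRestTrkSHFRQ PBot) :
    Summit.RiemannHypothesis.RiemannHypothesis.Theses.EarlyAppointments.TiltedLandingLaw421 :=
  law421T_of_round3SQ PBot hR alphaSealTrkS_botQ
end SealSwap

section Horizon

open Classical in
/-- ★★ §K.16d (K) **PRE-HORIZON DEPTH BOUND**: under β(Pσ) ∧ α(Pσ), if no level `< k` is Ready′ then every level `≤ k` is inhabited and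
`k + 4·lowH k/s ≤ (Hs/s)² + B + 1 + 4·hmax/s` (each pre-horizon level is charged — billed 1 — or free with a drop `≥ s/4` — billed `≥ 1` in the rate form). -/
theorem preHorizon_depth_leQ {Pσ : StatePred} (hR : ZRestTrkSHFRQ Pσ) (hα : AlphaSealTrkSQ Pσ) {η : ℝ} {f : ℂ → ℂ} {x₀ s hmax R Hs : ℝ} {B : ℕ}
    (hE : EngineHyps5 2 η f x₀ s hmax R Hs B) {k : ℕ} (hpre : ∀ i : ℕ, i < k → ∀ v : ℂ, ¬ ReadyR2 η f x₀ s hmax R Hs B i v) :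
    (∃ u : ℂ, StTrkDQ η f x₀ s hmax R Hs B k u) ∧
      (k : ℝ) + 4 * lowH StTrkDQ η f x₀ s hmax R Hs B k / s ≤ (Hs / s) ^ 2 + (B : ℝ) + 1 + 4 * hmax / s := by
  classical
  have hs : 0 < s := hE.2.2.2.1
  obtain ⟨hSn, hB⟩ := (zRestTrkSHFR_iff_rateQ Pσ).1 hR η f x₀ s hmax R Hs B hE
  have key : ∀ j : ℕ, j ≤ k → (∃ u : ℂ, StTrkDQ η f x₀ s hmax R Hs B j u) ∧
      (j : ℝ) ≤ chargeCount (PTrkSQ Pσ) StTrkDQ ReadyR2 η f x₀ s hmax R Hs B j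
        + ∑ i ∈ Finset.range j, (if Charged (PTrkSQ Pσ) StTrkDQ ReadyR2 η f x₀ s hmax R Hs B i then 0 else
            4 * (lowH StTrkDQ η f x₀ s hmax R Hs B i - lowH StTrkDQ η f x₀ s hmax R Hs B (i + 1)) / s) := by
    intro j
    induction j with
    | zero =>
      intro _
      obtain ⟨u, hu, -⟩ := init0Sig_stTrkDQ η f x₀ s hmax R Hs B hE
      refine ⟨⟨u, hu⟩, ?_⟩
      rw [chargeCount_zero, Finset.sum_range_zero]
      norm_num
    | succ j ih =>
      intro hjk
      have hjlt : j < k := Nat.lt_of_succ_le hjk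
      obtain ⟨⟨u, hu⟩, hih⟩ := ih hjlt.le
      rw [chargeCount_succ, Finset.sum_range_succ]
      push_cast
      by_cases hC : Charged (PTrkSQ Pσ) StTrkDQ ReadyR2 η f x₀ s hmax R Hs B j
      · obtain ⟨u', hu'⟩ := hSn j hC
        refine ⟨⟨u', hu'⟩, ?_⟩
        rw [if_pos hC, if_pos hC]
        linarith
      · obtain ⟨v, hv, hveq⟩ := exists_isLowest_eq_lowH levelFinite_stTrkDQ upperStates_stTrkDQ hE hu
        have hnr : ¬ ReadyR2 η f x₀ s hmax R Hs B j v := hpre j hjlt v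
        have hP : PTrkSQ Pσ η f x₀ s hmax R Hs B j v := by
          by_contra hnP
          exact hC ⟨v, hv, hnr, hnP⟩
        have hSucc : SuccOf (1 / 4) StTrkDQ η f x₀ s hmax R Hs B j v := by
          rcases hP with hσ | hsucc
          · exact hα η f x₀ s hmax R Hs B hE j v hv hnr hσ
          · exact hsucc
        obtain ⟨u', hu', hdrop⟩ := hSucc
        have h1 : lowH StTrkDQ η f x₀ s hmax R Hs B (j + 1) ≤ |u'.im| := lowH_le hu'
        refine ⟨⟨u', hu'⟩, ?_⟩
        rw [if_neg hC, if_neg hC]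
        have h2 : 1 ≤ 4 * (lowH StTrkDQ η f x₀ s hmax R Hs B j - lowH StTrkDQ η f x₀ s hmax R Hs B (j + 1)) / s := by
          rw [le_div_iff₀ hs]
          linarith
        linarith
  obtain ⟨hinh, hk⟩ := key k le_rfl
  refine ⟨hinh, ?_⟩
  have hcrd := le_max_right (tentMeterTrkD (3 / 2) η f x₀ s hmax R Hs B 0
    - injected (PTrkSQ Pσ) StTrkDQ ReadyR2 EmptyTrkDQ η f x₀ s hmax R Hs B k) 0
  have h3 := hB k
  linarith

/-- ★★★ §K.16d (K) **HORIZON (STOP-TIME) BOUND**: under β(Pσ) ∧ α(Pσ), on every legal frame Ready′ is switched on at some level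
`j ≤ (Hs/s)² + B + 1 + 4·hmax/s` (Ready′ is state-free). So C1's stop-time lemma (WORDS-47R H2) is a COROLLARY of the two stubs, not an extra hypothesis. -/
theorem exists_readyR2_leQ {Pσ : StatePred} (hR : ZRestTrkSHFRQ Pσ) (hα : AlphaSealTrkSQ Pσ) {η : ℝ} {f : ℂ → ℂ} {x₀ s hmax R Hs : ℝ} {B : ℕ}
    (hE : EngineHyps5 2 η f x₀ s hmax R Hs B) :
    ∃ j : ℕ, (j : ℝ) ≤ (Hs / s) ^ 2 + (B : ℝ) + 1 + 4 * hmax / s ∧ ∀ u : ℂ, ReadyR2 η f x₀ s hmax R Hs B j u := by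
  classical
  have hs : 0 < s := hE.2.2.2.1
  have hsh : 2 * s ≤ hmax := hE.2.2.2.2.1
  have hb : 0 ≤ (Hs / s) ^ 2 + (B : ℝ) + 1 + 4 * hmax / s := by
    have h1 : 0 ≤ (Hs / s) ^ 2 := sq_nonneg _
    have h2 : (0 : ℝ) ≤ (B : ℝ) := Nat.cast_nonneg _
    have h3 : 0 ≤ 4 * hmax / s := div_nonneg (by linarith) hs.le
    linarith
  by_contra hcon
  have hall : ∀ i : ℕ, i < ⌊(Hs / s) ^ 2 + (B : ℝ) + 1 + 4 * hmax / s⌋₊ + 1 → ∀ v : ℂ, ¬ ReadyR2 η f x₀ s hmax R Hs B i v := by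
    intro i hi v hv
    apply hcon
    refine ⟨i, ?_, fun u => stateFree_readyR2 η f x₀ s hmax R Hs B i v u hv⟩
    have h1 : (i : ℝ) ≤ (⌊(Hs / s) ^ 2 + (B : ℝ) + 1 + 4 * hmax / s⌋₊ : ℝ) := by
      exact_mod_cast Nat.lt_succ_iff.mp hi
    exact h1.trans (Nat.floor_le hb)
  obtain ⟨-, hdepth⟩ := preHorizon_depth_leQ hR hα hE hall
  have h2 : 0 ≤ 4 * lowH StTrkDQ η f x₀ s hmax R Hs B (⌊(Hs / s) ^ 2 + (B : ℝ) + 1 + 4 * hmax / s⌋₊ + 1) / s :=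
    div_nonneg (mul_nonneg (by norm_num) (lowH_nonneg _ _ _ _ _ _ _ _ _ _)) hs.le
  have h3 := Nat.lt_floor_add_one ((Hs / s) ^ 2 + (B : ℝ) + 1 + 4 * hmax / s)
  push_cast at hdepth
  linarith

/-- (K) the α-FREE instance of the horizon bound: `β(PBot)` alone bounds the horizon. -/
theorem exists_readyR2_le_alphaFreeQ (hR : ZRestTrkSHFRQ PBot) {η : ℝ} {f : ℂ → ℂ} {x₀ s hmax R Hs : ℝ} {B : ℕ}
    (hE : EngineHyps5 2 η f x₀ s hmax R Hs B) :
    ∃ j : ℕ, (j : ℝ) ≤ (Hs / s) ^ 2 + (B : ℝ) + 1 + 4 * hmax / s ∧ ∀ u : ℂ, ReadyR2 η f x₀ s hmax R Hs B j u :=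
  exists_readyR2_leQ hR alphaSealTrkS_botQ hE
end Horizon

end RhW08.SealSwapQ

namespace RhW08.SealSwapQ

open Complex
open RhIdea6.G17.W07C7 RhIdea6.G17.W07C7.Rev6 RhIdea6.G18.W07C8.Law421BirthS RhIdea6.G19.W07C11.Seam
open RhIdea6.G20.W07C12.Frac RhIdea6.G20.W07C12.StColP RhW07.C12.FieldSplit RhIdea6.G21.W07C13.TentMax
open RhW07.C14.TwoSided RhW07.C14.Classes RhW07.C14.Lineage RhW07.C14.Booking
open RhW07.C13.Heredity RhIdea6.G22.W07C15pre.Injection RhW07.E3.Cell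
open RhW07.E3.Lit
open RhW08.Round1 RhW08.StSwap RhW08.Round2 RhW08.QuadW
open RhW08.SealSwap (PBot)

section BotStubs

/-- ★★★ §R3B STUB TEXT 1 — (S♮) «NO SILENT EXTINCTION» at the empty seal: on every legal frame (`EngineHyps5 2`), every CHARGED level `j` of the seal-free
family `PTrkSQ PBot` (its lowest tracked state is not Ready′ — no sign window and no 421-event at any level `≤ j` near the column — and NO tracked state of level `j+1`
sits at least `s/4` lower, cf. `chargedBot_iffQ`) still has an INHABITED tracked successor level `j+1`.
Q-FAMILY READING (W-08 round 3b, director (CA334) OPTION (Q)): «tracked level `j+1`» = a `StTrkDQ … (j+1)` state, i.e. a non-real zero `u'` of `f^{(j+1)}` with `0 < Im u' ≤ Hs`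
in the QUADRATIC window `(Re u' − x₀)² + (j+1)·(Im u')² ≤ (j+1)·Hs²` (plus the part-1 typing's nesting clause, if any: (i) chain / (ii′) hang / (iii) window-only = none).
Analytic content (why it is a genuine stub): a Laguerre/Jensen step for real entire `f` of order `< 2` with all zeros in `|Im| ≤ Hs` — «level `j` charged (no sign window, no
421-event near the column up to level `j`) ⇒ `f^{(j+1)}` still has a non-real zero in `Q_{j+1}`»; Jensen nesting (`RhW08.QuadW.quad_step'`, `quad_of_hang`) discharges the window for a
child nested under a Q-parent; the residual is the cluster case (C6 frames A/B/C: ADD-86/87/92) where the child hangs under a NON-Q mate or no non-real child survives un-Ready.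
Why it might fail: a charged level whose every Q-state loses its couple to the real axis WITHOUT an in-range tilt, or whose surviving children all leave `Q_{j+1}`. -/
def RestSuccBotQ : Prop :=
  ∀ (η : ℝ) (f : ℂ → ℂ) (x₀ s hmax R Hs : ℝ) (B : ℕ), EngineHyps5 2 η f x₀ s hmax R Hs B →
    ∀ j : ℕ, Charged (PTrkSQ PBot) StTrkDQ ReadyR2 η f x₀ s hmax R Hs B j → ∃ u' : ℂ, StTrkDQ η f x₀ s hmax R Hs B (j + 1) u'

open Classical in
/-- ★★★ §R3B STUB TEXT 2 — (R) «THE RATE INEQUALITY» of the seal-free signed REST at the booked-root meter (telescoped rate form of β(⊥), C4 §K.16c): on every legal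
frame, for EVERY prefix `k`,
`chargeCount k + (T₀ᴿ − injected k)⁺ + 4·lowH k/s + Σ_{j<k}[¬Charged j] 4·(lowH j − lowH (j+1))/s ≤ (Hs/s)² + B + 1 + 4·hmax/s`
(«charged levels so far + unspent root credit + current lowest tracked height in units of `s/4` + the drops of the FREE levels in units of `s/4` ≤ LAW 421's depth purse»;
`T₀ᴿ = tentMeterTrkD (3/2) … 0` the booked root's `3/2`-tent count, `injected k` the charged NON-empty-tent levels below `k`, `lowH j` the lowest tracked height of level `j`).
The `k = 0` instance is INIT♯ (`restInitBot_of_rateQ`). Why it might fail: a HOVERING un-ready lineage (many charged levels with drop ≈ 0 after the credit window `injected k ≤ T₀ᴿ`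
closes, cost ≈ 1 each) in a low-budget frame; C6 ADD-84: NEG 0 / 2 200 comb frames, floor +1.000 at `k = 0`. -/
def RestRateBotQ : Prop :=
  ∀ (η : ℝ) (f : ℂ → ℂ) (x₀ s hmax R Hs : ℝ) (B : ℕ), EngineHyps5 2 η f x₀ s hmax R Hs B →
    ∀ k : ℕ, chargeCount (PTrkSQ PBot) StTrkDQ ReadyR2 η f x₀ s hmax R Hs B k
        + max (tentMeterTrkD (3 / 2) η f x₀ s hmax R Hs B 0 - injected (PTrkSQ PBot) StTrkDQ ReadyR2 EmptyTrkDQ η f x₀ s hmax R Hs B k) 0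
        + 4 * lowH StTrkDQ η f x₀ s hmax R Hs B k / s
        + (∑ j ∈ Finset.range k, (if Charged (PTrkSQ PBot) StTrkDQ ReadyR2 η f x₀ s hmax R Hs B j then 0 else
            4 * (lowH StTrkDQ η f x₀ s hmax R Hs B j - lowH StTrkDQ η f x₀ s hmax R Hs B (j + 1)) / s))
      ≤ (Hs / s) ^ 2 + (B : ℝ) + 1 + 4 * hmax / s

/-- ★ §R3B the k-0 INIT♯ text in HEIGHT-PURSE units (director (CA328)(3) wording): on every legal frame `0 ≤ heightBudget (tentMeterTrkD (3/2)) StTrkDQ …`, i.e.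
`T₀ᴿ ≤ (Hs/s)² + B + 1 + 4·(hmax − rootHeight)/s` (`restInitBot_iff_purseQ`). NOT a stub of the round-3 line: it is the `k = 0` instance of `RestRateBotQ` (`restInitBot_of_rateQ`)
and C4 §K.17 proves it on all legal data (helper). -/
def RestInitBotQ : Prop :=
  ∀ (η : ℝ) (f : ℂ → ℂ) (x₀ s hmax R Hs : ℝ) (B : ℕ), EngineHyps5 2 η f x₀ s hmax R Hs B →
    0 ≤ heightBudget (tentMeterTrkD (3 / 2)) StTrkDQ η f x₀ s hmax R Hs B

/-- (K) §R3B the rate form of β(⊥) IS the conjunction of the two stub texts (frame-wise regrouping, no mathematics). -/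
theorem rateRestTrkS_bot_iffQ : RateRestTrkSQ PBot ↔ (RestSuccBotQ ∧ RestRateBotQ) :=
  ⟨fun h => ⟨fun η f x₀ s hmax R Hs B hE => (h η f x₀ s hmax R Hs B hE).1, fun η f x₀ s hmax R Hs B hE => (h η f x₀ s hmax R Hs B hE).2⟩,
    fun h η f x₀ s hmax R Hs B hE => ⟨h.1 η f x₀ s hmax R Hs B hE, h.2 η f x₀ s hmax R Hs B hE⟩⟩

/-- ★★★ §R3B (K) **THE PROVED COMPOSITION OF OPTION B**: `RestSuccBotQ → RestRateBotQ → ZRestTrkSHFRQ PBot` (via C4 `zRestTrkSHFR_iff_rateQ PBot`). -/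
theorem zRestTrkSBot_of_succ_rateQ (hS : RestSuccBotQ) (hR : RestRateBotQ) : ZRestTrkSHFRQ PBot :=
  (zRestTrkSHFR_iff_rateQ PBot).mpr (rateRestTrkS_bot_iffQ.mpr ⟨hS, hR⟩)

/-- (K) §R3B conversely β(⊥) returns stub text 1 … -/
theorem restSuccBot_of_botQ (h : ZRestTrkSHFRQ PBot) : RestSuccBotQ :=
  (rateRestTrkS_bot_iffQ.mp ((zRestTrkSHFR_iff_rateQ PBot).mp h)).1

/-- (K) §R3B … and stub text 2: the split loses nothing. -/
theorem restRateBot_of_botQ (h : ZRestTrkSHFRQ PBot) : RestRateBotQ :=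
  (rateRestTrkS_bot_iffQ.mp ((zRestTrkSHFR_iff_rateQ PBot).mp h)).2

/-- ★★ §R3B (K) `β(⊥) ↔ RestSuccBotQ ∧ RestRateBotQ`. -/
theorem zRestTrkSHFR_bot_iff_succ_rateQ : ZRestTrkSHFRQ PBot ↔ (RestSuccBotQ ∧ RestRateBotQ) :=
  ⟨fun h => ⟨restSuccBot_of_botQ h, restRateBot_of_botQ h⟩, fun h => zRestTrkSBot_of_succ_rateQ h.1 h.2⟩

/-- ★★★ §R3B (K) **THE ROUND-3 NODE BY NAMES**: `RestSuccBotQ → RestRateBotQ → TiltedLandingLaw421` (`law421T_of_alphaFreeQ ∘ zRestTrkSBot_of_succ_rateQ`). -/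
theorem law421T_of_succ_rateQ (hS : RestSuccBotQ) (hR : RestRateBotQ) :
    Summit.RiemannHypothesis.RiemannHypothesis.Theses.EarlyAppointments.TiltedLandingLaw421 :=
  law421T_of_alphaFreeQ (zRestTrkSBot_of_succ_rateQ hS hR)

/-- ★ §R3B (K) the STOP-TIME bound is a corollary of the two stub texts (C4 §K.16d `exists_readyR2_le_alphaFreeQ`): `∃ j ≤ (Hs/s)² + B + 1 + 4hmax/s, ∀ u, ReadyR2 … j u`. -/
theorem exists_readyR2_le_of_succ_rateQ (hS : RestSuccBotQ) (hR : RestRateBotQ) {η : ℝ} {f : ℂ → ℂ} {x₀ s hmax R Hs : ℝ} {B : ℕ}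
    (hE : EngineHyps5 2 η f x₀ s hmax R Hs B) :
    ∃ j : ℕ, (j : ℝ) ≤ (Hs / s) ^ 2 + (B : ℝ) + 1 + 4 * hmax / s ∧ ∀ u : ℂ, ReadyR2 η f x₀ s hmax R Hs B j u :=
  exists_readyR2_le_alphaFreeQ (zRestTrkSBot_of_succ_rateQ hS hR) hE

/-- ★★ §R3B (K) THE SEAL-FREE CHARGE PREDICATE IN WORDS: level `j` is charged iff its lowest tracked state `v` is not Ready′ and EVERY tracked state of level `j+1` is
`< s/4` lower than `v` (no seal clause at all — this is the column C6/C2/critic price as R5ᴿ(⊥)). -/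
theorem chargedBot_iffQ {η : ℝ} {f : ℂ → ℂ} {x₀ s hmax R Hs : ℝ} {B j : ℕ} :
    Charged (PTrkSQ PBot) StTrkDQ ReadyR2 η f x₀ s hmax R Hs B j ↔
      ∃ v : ℂ, IsLowest StTrkDQ η f x₀ s hmax R Hs B j v ∧ ¬ ReadyR2 η f x₀ s hmax R Hs B j v ∧
        ∀ u' : ℂ, StTrkDQ η f x₀ s hmax R Hs B (j + 1) u' → |v.im| < |u'.im| + 1 / 4 * s := by
  constructor
  · rintro ⟨v, hlow, hnr, hnP⟩
    refine ⟨v, hlow, hnr, fun u' hu' => ?_⟩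
    by_contra h
    exact hnP (Or.inr ⟨u', hu', not_lt.mp h⟩)
  · rintro ⟨v, hlow, hnr, hall⟩
    refine ⟨v, hlow, hnr, fun h => ?_⟩
    rcases h with hb | ⟨u', hu', hle⟩
    · exact hb.elim
    · exact absurd hle (not_le.mpr (hall u' hu'))

/-- (K) §R3B INIT♯ in purse units: `RestInitBotQ ↔ ∀ legal frame, T₀ᴿ ≤ (Hs/s)² + B + 1 + 4·(hmax − rootHeight StTrkDQ)/s` (= the statement C4 §K.17 `tentMeterTrkD_zero_le_purse` proves). -/
theorem restInitBot_iff_purseQ : RestInitBotQ ↔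
    ∀ (η : ℝ) (f : ℂ → ℂ) (x₀ s hmax R Hs : ℝ) (B : ℕ), EngineHyps5 2 η f x₀ s hmax R Hs B →
      tentMeterTrkD (3 / 2) η f x₀ s hmax R Hs B 0 ≤ (Hs / s) ^ 2 + (B : ℝ) + 1 + 4 * (hmax - rootHeight StTrkDQ η f x₀ s hmax R Hs B) / s := by
  constructor
  · intro h η f x₀ s hmax R Hs B hE
    have h1 := h η f x₀ s hmax R Hs B hE
    simp only [heightBudget] at h1
    linarith
  · intro h η f x₀ s hmax R Hs B hE
    have h1 := h η f x₀ s hmax R Hs B hE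
    simp only [heightBudget]
    linarith

/-- ★ §R3B (K) INIT♯ IS THE `k = 0` INSTANCE OF THE RATE INEQUALITY (`chargeCount 0 = 0`, `injected 0 = 0`, `lowH 0 = rootHeight`, empty free-drop sum, `T₀ᴿ ≤ (T₀ᴿ − 0)⁺`) —
so a separate INIT stub would be redundant next to `RestRateBotQ`. -/
theorem restInitBot_of_rateQ (h : RestRateBotQ) : RestInitBotQ := by
  classical
  intro η f x₀ s hmax R Hs B hE
  have h0 := h η f x₀ s hmax R Hs B hE 0
  rw [chargeCount_zero, lowH_zero, Finset.sum_range_zero] at h0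
  have hinj : injected (PTrkSQ PBot) StTrkDQ ReadyR2 EmptyTrkDQ η f x₀ s hmax R Hs B 0 = 0 := by simp [injected]
  rw [hinj, sub_zero] at h0
  have hT : tentMeterTrkD (3 / 2) η f x₀ s hmax R Hs B 0 ≤ max (tentMeterTrkD (3 / 2) η f x₀ s hmax R Hs B 0) 0 := le_max_left _ _
  have h4 : 4 * (hmax - rootHeight StTrkDQ η f x₀ s hmax R Hs B) / s = 4 * hmax / s - 4 * rootHeight StTrkDQ η f x₀ s hmax R Hs B / s := by ring
  simp only [heightBudget]
  rw [h4]
  linarith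
end BotStubs

section InitQ

/-- (K) §Q.5 INIT♯^Q, step 1 (typing-robust: uses only `stTrkDQ_zero_of_stTrkD_zero`): the Q-family's level 0 CONTAINS the root-column states, so its ROOT HEIGHT is at most
the round-3 root height (`sInf` over a larger set, bounded below by `0`, the smaller set inhabited by the seed). -/
theorem rootHeight_stTrkDQ_le {η : ℝ} {f : ℂ → ℂ} {x₀ s hmax R Hs : ℝ} {B : ℕ} (hE : EngineHyps5 2 η f x₀ s hmax R Hs B) :
    rootHeight StTrkDQ η f x₀ s hmax R Hs B ≤ rootHeight StTrkD η f x₀ s hmax R Hs B := by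
  unfold rootHeight
  apply csInf_le_csInf
  · exact ⟨0, fun r ⟨u, _, hr⟩ => hr ▸ abs_nonneg _⟩
  · obtain ⟨u, hu, -⟩ := init0Sig_stTrkD η f x₀ s hmax R Hs B hE
    exact ⟨|u.im|, u, hu, rfl⟩
  · exact Set.image_mono (fun u hu => stTrkDQ_zero_of_stTrkD_zero hu)

/-- (K) §Q.5 step 2: hence the Q-family's HEIGHT PURSE is at least the round-3 one, for any meter. -/
theorem heightBudget_stTrkD_le_stTrkDQ (M : LevelMeter) {η : ℝ} {f : ℂ → ℂ} {x₀ s hmax R Hs : ℝ} {B : ℕ} (hE : EngineHyps5 2 η f x₀ s hmax R Hs B) :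
    heightBudget M StTrkD η f x₀ s hmax R Hs B ≤ heightBudget M StTrkDQ η f x₀ s hmax R Hs B := by
  have h := rootHeight_stTrkDQ_le hE
  have hs : 0 < s := hE.2.2.2.1
  have h4 : 4 * (hmax - rootHeight StTrkD η f x₀ s hmax R Hs B) / s ≤ 4 * (hmax - rootHeight StTrkDQ η f x₀ s hmax R Hs B) / s :=
    div_le_div_of_nonneg_right (by linarith) hs.le
  simp only [heightBudget]
  linarith

/-- ★ (K) §Q.5 **INIT♯ ⇒ INIT♯^Q** (typing-robust): the round-3 root inequality `RestInitBot` implies the Q-family's `RestInitBotQ` on every legal frame, so image A's discharge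
(`…R2InitR` #1015) + the round-3 `restInitBot` transport with no new analysis — under EVERY part-1 typing whose level 0 contains the root-column states (chain, hang, window, band, hull). -/
theorem restInitBotQ_of_restInitBot (h : RhW08.SealSwap.RestInitBot) : RestInitBotQ :=
  fun η f x₀ s hmax R Hs B hE => le_trans (h η f x₀ s hmax R Hs B hE) (heightBudget_stTrkD_le_stTrkDQ _ hE)
end InitQ

end RhW08.SealSwapQ
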